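import Summits.QuantumAdvantage.QuantumAdvantage.Theorems.CubicForrelationNearExactIsExactFourteenTypeO
import Summits.QuantumAdvantage.QuantumAdvantage.Theorems.CubicForrelationNearExactIsExactEightSymplectic

/-!
# Crux `CubicForrelation.NearExactIsExact` (stmt-QuantumAdvantage-14043) — n = 14 at the SECOND boundary `15/16`: digit tools
  (the second digit of a cubic's Walsh spectrum is CUBIC when the first digit has rank `≤ 2`)

Certificate seat `b2b-cforr-cert` (gen 9).  HONEST FRAMING: lemmas about cubic Boolean functions on 14 bits (inputs to the case analysis
of `Φ ≥ 15/16 ⇒ Φ = 1` on the finite slice `n = 14`, the `n ≡ 2 (mod 6)` instance of the second dyadic boundary) — NOT summit progress.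

For a cubic `g` on 14 bits write `W_g = 32u` (Ax).  The digits `d₁ = [⌊u/2⌋ odd]` (quadratic, `fd_digitOne`) and `d₂ = [⌊u/4⌋ odd]`
(quartic, `fd_digitTwo`) are linked: the 4-cube sums of `u` are `≡ 0 (mod 8)`, so the degree-4 part of `d₂` is the 4-Pfaffian form of
`d₁` — it vanishes exactly when `d₁` has rank `≤ 2`.  Coordinate-free version proved here (`fo_digitTwo_cubic`): if the RADICAL
`R = {a : d₁(0) ⊕ d₁(a) ⊕ d₁(b) ⊕ d₁(a ⊕ b) = 0 ∀ b}` has `#R ≥ 2¹²`, then `d₂` has degree `≤ 3`.  Ingredients: `fo_card_mul_le_inter`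
(`#A·#B ≤ 2ⁿ·#(A ∩ B)` for `⊕`-closed `A, B`, giving a non-zero radical vector inside every coordinate 4-cube) and `fo_quad_cube4` (such a
vector makes the weight of the quadratic on the cube `≡ 0 (mod 4)`).

References: J. Ax (1964) / R. J. McEliece (1972); MacWilliams–Sloane (1977) Ch. 13–15; C. Carlet (2021) §5.2.  Everything below is
proved from Mathlib and the tree; axioms are the standard three.
-/

set_option linter.dupNamespace false -- D-0017: single-problem summit ⇒ `QuantumAdvantage.QuantumAdvantage` by design

noncomputable section

namespace Summit.QuantumAdvantage.QuantumAdvantage.Theorems.CubicForrelation.NearExactIsExact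

open Finset
open Literature.Computability.QuantumComplexity
open Literature.Computability.QuantumComplexity.BuzetChailloux (bxor zeroVec bxor_bxor_cancel_left bxor_zeroVec zeroVec_bxor bxor_comm
  bxor_self)
open Literature.Computability.QuantumComplexity.DerivativeWalsh (W)

variable {n : ℕ}

/-! ### Two counting tools -/

/-- **`#A·#B ≤ 2ⁿ·#(A ∩ B)` for `⊕`-closed `A, B ⊆ 𝔽₂ⁿ`** (the fibres of `(a,b) ↦ a ⊕ b` on `A × B` inject into `A ∩ B`).
[folklore] -/
theorem fo_card_mul_le_inter (A B : Finset (Fin n → Bool))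
    (hA : ∀ a ∈ A, ∀ a' ∈ A, bxor a a' ∈ A) (hB : ∀ b ∈ B, ∀ b' ∈ B, bxor b b' ∈ B) :
    #A * #B ≤ 2 ^ n * #(A ∩ B) := by
  classical
  rw [← card_product]
  have hmap : ∀ p ∈ A ×ˢ B, (fun p : (Fin n → Bool) × (Fin n → Bool) => bxor p.1 p.2) p ∈ (univ : Finset (Fin n → Bool)) :=
    fun p _ => mem_univ _
  rw [card_eq_sum_card_fiberwise hmap]
  have hfib : ∀ z ∈ (univ : Finset (Fin n → Bool)),
      #((A ×ˢ B).filter fun p => bxor p.1 p.2 = z) ≤ #(A ∩ B) := by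
    intro z _
    by_cases hz : ((A ×ˢ B).filter fun p => bxor p.1 p.2 = z) = ∅
    · rw [hz, card_empty]; exact Nat.zero_le _
    obtain ⟨p₀, hp₀⟩ := nonempty_iff_ne_empty.2 hz
    have hp₀' := mem_filter.1 hp₀
    have hp₀A : p₀.1 ∈ A := (mem_product.1 hp₀'.1).1
    have hp₀B : p₀.2 ∈ B := (mem_product.1 hp₀'.1).2
    refine card_le_card_of_injOn (fun p => bxor p₀.1 p.1) (fun p hp => ?_) (fun p hp p' hp' h => ?_)
    · have hp1 := mem_filter.1 hp
      have hpA : p.1 ∈ A := (mem_product.1 hp1.1).1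
      have hpB : p.2 ∈ B := (mem_product.1 hp1.1).2
      have e : bxor p₀.1 p.1 = bxor p₀.2 p.2 := by
        funext i
        have h1 := congrFun hp₀'.2 i
        have h2 := congrFun hp1.2 i
        simp only [bxor] at h1 h2 ⊢
        revert h1 h2
        cases p₀.1 i <;> cases p₀.2 i <;> cases p.1 i <;> cases p.2 i <;> cases z i <;> decide
      rw [mem_coe, mem_inter]
      refine ⟨hA _ hp₀A _ hpA, ?_⟩
      show bxor p₀.1 p.1 ∈ B
      rw [e]
      exact hB _ hp₀B _ hpB
    · have hp1 := mem_filter.1 hp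
      have hp2 := mem_filter.1 hp'
      have h1 : p.1 = p'.1 := by simpa only [bxor_bxor_cancel_left] using congrArg (bxor p₀.1) h
      have h2 : p.2 = p'.2 := by
        have e1 : p.2 = bxor p.1 z := by rw [← hp1.2, bxor_bxor_cancel_left]
        have e2 : p'.2 = bxor p'.1 z := by rw [← hp2.2, bxor_bxor_cancel_left]
        rw [e1, e2, h1]
      exact Prod.ext h1 h2
  calc ∑ z ∈ (univ : Finset (Fin n → Bool)), #((A ×ˢ B).filter fun p => bxor p.1 p.2 = z)
      ≤ ∑ _z ∈ (univ : Finset (Fin n → Bool)), #(A ∩ B) := sum_le_sum hfib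
    _ = 2 ^ n * #(A ∩ B) := by rw [sum_const, card_univ, Fintype.card_fun, Fintype.card_bool, Fintype.card_fin, smul_eq_mul]

/-- A quadratic `q` with a non-zero RADICAL vector `a` supported inside a coordinate set `I` of size `4` (`B_q(a,·) ≡ 0`) has weight
`≡ 0 (mod 4)` on the cube `E_I`: the involution `x ↦ x ⊕ a` of `E_I` shifts `q` by the constant `q(0) ⊕ q(a)`; if that constant is `1`
the weight is `8`, if it is `0` the weight is twice the (even) weight of `q` on a 3-cube. [this work] -/
theorem fo_quad_cube4 (q : (Fin n → Bool) → Bool) (hq : IsDegLeFun 2 q) (I : Finset (Fin n)) (hI : #I = 4)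
    (a : Fin n → Bool) (haI : ∀ i, a i = true → i ∈ I) (ha0 : a ≠ zeroVec)
    (hrad : ∀ b, (q zeroVec ^^ q a ^^ q b ^^ q (bxor a b)) = false) :
    (4 : ℤ) ∣ #{x : Fin n → Bool | (∀ i, x i = true → i ∈ I) ∧ q x = true} := by
  classical
  -- the shift along `a`
  have hshift : ∀ x, q (bxor x a) = (q x ^^ (q zeroVec ^^ q a)) := by
    intro x
    have h := hrad x
    rw [bxor_comm] at h
    revert h
    cases q zeroVec <;> cases q a <;> cases q x <;> cases q (bxor x a) <;> decide
  have hcube : ∀ x : Fin n → Bool, (∀ i, x i = true → i ∈ I) → ∀ i, bxor x a i = true → i ∈ I := by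
    intro x hx i hi
    simp only [bxor] at hi
    cases hxi : x i with
    | true => exact hx i hxi
    | false => rw [hxi] at hi; exact haI i (by simpa using hi)
  obtain ⟨i₀, hi₀⟩ : ∃ i, a i = true := by
    by_contra h
    push Not at h
    exact ha0 (funext fun i => by simpa [zeroVec] using h i)
  have hi₀I : i₀ ∈ I := haI i₀ hi₀
  by_cases hc : (q zeroVec ^^ q a) = true
  · -- `q(x ⊕ a) = ¬ q x`: the ones and the zeros of `q` on the cube are in bijection
    have hflip : ∀ x, q (bxor x a) = !q x := fun x => by rw [hshift x, hc]; cases q x <;> rfl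
    have hbij : #{x : Fin n → Bool | (∀ i, x i = true → i ∈ I) ∧ q x = true} =
        #{x : Fin n → Bool | (∀ i, x i = true → i ∈ I) ∧ q x = false} := by
      refine card_nbij' (fun x => bxor x a) (fun x => bxor x a) (fun x hx => ?_) (fun x hx => ?_)
        (fun x _ => by show bxor (bxor x a) a = x; rw [iw_bxor_assoc, bxor_self, bxor_zeroVec])
        (fun x _ => by show bxor (bxor x a) a = x; rw [iw_bxor_assoc, bxor_self, bxor_zeroVec])
      · rw [mem_coe, mem_filter] at hx ⊢
        exact ⟨mem_univ _, hcube x hx.2.1, by rw [hflip x, hx.2.2]; rfl⟩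
      · rw [mem_coe, mem_filter] at hx ⊢
        exact ⟨mem_univ _, hcube x hx.2.1, by rw [hflip x, hx.2.2]; rfl⟩
    have htot := Finset.card_filter_add_card_filter_not
      (s := univ.filter fun x : Fin n → Bool => ∀ i, x i = true → i ∈ I) (fun x => q x = true)
    rw [filter_filter, filter_filter, bb_card_cube, hI] at htot
    simp only [Bool.not_eq_true] at htot
    have h8 : #{x : Fin n → Bool | (∀ i, x i = true → i ∈ I) ∧ q x = true} = 8 := by omega
    rw [h8]; norm_num
  · -- `q` is `a`-periodic on the cube: its ones split evenly across `x_{i₀} = 0 / 1`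
    have hper : ∀ x, q (bxor x a) = q x := fun x => by
      rw [hshift x]; revert hc; cases q zeroVec <;> cases q a <;> cases q x <;> decide
    set T := univ.filter (fun x : Fin n → Bool => (∀ i, x i = true → i ∈ I) ∧ q x = true) with hT
    have hsplit : #T = #(T.filter fun x => x i₀ = false) + #(T.filter fun x => ¬ x i₀ = false) :=
      (Finset.card_filter_add_card_filter_not (s := T) (fun x => x i₀ = false)).symm
    have hhalf : #(T.filter fun x => ¬ x i₀ = false) = #(T.filter fun x => x i₀ = false) := by
      refine card_nbij' (fun x => bxor x a) (fun x => bxor x a) (fun x hx => ?_) (fun x hx => ?_)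
        (fun x _ => by show bxor (bxor x a) a = x; rw [iw_bxor_assoc, bxor_self, bxor_zeroVec])
        (fun x _ => by show bxor (bxor x a) a = x; rw [iw_bxor_assoc, bxor_self, bxor_zeroVec])
      · rw [mem_coe, mem_filter, hT, mem_filter] at hx
        rw [mem_coe, mem_filter, hT, mem_filter]
        refine ⟨⟨mem_univ _, hcube x hx.1.2.1, by rw [hper x, hx.1.2.2]⟩, ?_⟩
        have : x i₀ = true := by simpa using hx.2
        simp [bxor, this, hi₀]
      · rw [mem_coe, mem_filter, hT, mem_filter] at hx
        rw [mem_coe, mem_filter, hT, mem_filter]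
        refine ⟨⟨mem_univ _, hcube x hx.1.2.1, by rw [hper x, hx.1.2.2]⟩, ?_⟩
        simp [bxor, hx.2, hi₀]
    -- the `x_{i₀} = 0` half is the cube on `I \ {i₀}`, where a quadratic has even weight
    have hsub : T.filter (fun x => x i₀ = false) =
        univ.filter (fun x : Fin n → Bool => (∀ i, x i = true → i ∈ I.erase i₀) ∧ q x = true) := by
      ext x
      simp only [hT, mem_filter, mem_univ, true_and, mem_erase]
      constructor
      · rintro ⟨⟨hx, hqx⟩, hx0⟩
        exact ⟨fun i hi => ⟨fun h => by rw [h, hx0] at hi; exact Bool.noConfusion hi, hx i hi⟩, hqx⟩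
      · rintro ⟨hx, hqx⟩
        refine ⟨⟨fun i hi => (hx i hi).2, hqx⟩, ?_⟩
        by_contra h
        have : x i₀ = true := by simpa using h
        exact (hx i₀ this).1 rfl
    obtain ⟨z, hz⟩ := td_count_cube (by norm_num : 1 ≤ 2) q hq (I.erase i₀)
    rw [card_erase_of_mem hi₀I, hI, show (4 - 1 : ℕ) = 3 from rfl, show ((3 + 2 - 1) / 2 : ℕ) = 2 from rfl] at hz
    have heven : (2 : ℤ) ∣ #{x : Fin n → Bool | (∀ i, x i = true → i ∈ I.erase i₀) ∧ q x = true} :=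
      ⟨2 - z, by linarith⟩
    rw [← hsub] at heven
    have e : (#T : ℤ) = 2 * #(T.filter fun x => x i₀ = false) := by rw [hsplit, hhalf]; push_cast; ring
    obtain ⟨k, hk⟩ := heven
    exact ⟨k, by rw [e, hk]; ring⟩


/-! ### The second digit is cubic when the radical of the first digit is large -/

/-- **Digit two is CUBIC when `rank d₁ ≤ 2`.**  For a cubic `g` on 14 bits (`W_g = 32u`; either type) whose first digit
`d₁ = [⌊u/2⌋ odd]` has a radical `R = {a : d₁(0) ⊕ d₁(a) ⊕ d₁(b) ⊕ d₁(a ⊕ b) = 0 ∀ b}` with `#R ≥ 2¹²`, the second digit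
`d₂ = [⌊u/4⌋ odd]` has degree `≤ 3`: on a coordinate 4-cube the sum of `u` is `≡ 0 (mod 8)` (Ax), the parity of `u` is constant, and the
weight of `d₁` is `≡ 0 (mod 4)` (`fo_quad_cube4` with a radical vector in the cube, which exists by `fo_card_mul_le_inter`), so the
cube sum of `d₂` is even; larger cubes as in `fd_digitTwo`. [this work] -/
theorem fo_digitTwo_cubic (g : (Fin (7 + 7) → Bool) → Bool) (u : (Fin (7 + 7) → Bool) → ℤ) (hg : IsDegLeFun 3 g)
    (hu : ∀ x, W (fun y => signOf (g y)) x = (2 : ℝ) ^ 5 * (u x : ℝ))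
    (hrad : 2 ^ 12 ≤ #(univ.filter fun a : Fin (7 + 7) → Bool => ∀ b,
      (decide (Odd (u zeroVec / 2)) ^^ decide (Odd (u a / 2)) ^^ decide (Odd (u b / 2)) ^^ decide (Odd (u (bxor a b) / 2))) = false)) :
    IsDegLeFun 3 (fun x => decide (Odd (u x / 2 / 2))) := by
  classical
  have hP0 := fd_digitZero g u hg hu
  have hP1 := fd_digitOne g u hg hu
  set R := univ.filter (fun a : Fin (7 + 7) → Bool => ∀ b,
      (decide (Odd (u zeroVec / 2)) ^^ decide (Odd (u a / 2)) ^^ decide (Odd (u b / 2)) ^^ decide (Odd (u (bxor a b) / 2))) = false)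
    with hRdef
  have haddR : ∀ a ∈ R, ∀ a' ∈ R, bxor a a' ∈ R := by
    intro a ha a' ha'
    refine mem_filter.2 ⟨mem_univ _, fun b => ?_⟩
    rw [es_B_add_left (fun x => decide (Odd (u x / 2))) hP1 a a' b, (mem_filter.1 ha).2 b, (mem_filter.1 ha').2 b]
    rfl
  refine bb_moebius_isDegLeFun 3 _ fun I hI => ?_
  have hk : #I ≤ 7 + 7 := (card_le_univ I).trans_eq (Fintype.card_fin _)
  obtain ⟨z, hz⟩ := fd_cube_sum g u hg hu I
  have h8 : (2 : ℤ) ^ 3 ∣ ∑ x ∈ {x : Fin (7 + 7) → Bool | ∀ i, x i = true → i ∈ I}, u x :=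
    fd_dvd_of_balance (by omega) hz
  obtain ⟨z', hz'⟩ := td_count_cube (le_refl 1) (fun x => decide (Odd (u x))) (hP0.mono (by norm_num)) I
  rw [show (#I + 1 - 1) / 1 = #I by simp] at hz'
  have hA : (8 : ℤ) ∣ #{x : Fin (7 + 7) → Bool | (∀ i, x i = true → i ∈ I) ∧ decide (Odd (u x)) = true} := by
    obtain ⟨e, he⟩ : ∃ e, #I = e + 4 := ⟨#I - 4, by omega⟩
    rw [he, show (2 : ℤ) ^ (e + 4) = 2 ^ e * 16 by rw [pow_add]; norm_num] at hz'
    exact ⟨2 ^ e * (1 - z'), by linarith⟩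
  have hB : (4 : ℤ) ∣ #{x : Fin (7 + 7) → Bool | (∀ i, x i = true → i ∈ I) ∧ decide (Odd (u x / 2)) = true} := by
    by_cases h4 : #I = 4
    · -- a non-zero radical vector inside the cube
      set C := univ.filter (fun a : Fin (7 + 7) → Bool => ∀ i, a i = true → i ∈ I) with hCdef
      have haddC : ∀ a ∈ C, ∀ a' ∈ C, bxor a a' ∈ C := by
        intro a ha a' ha'
        refine mem_filter.2 ⟨mem_univ _, fun i hi => ?_⟩
        simp only [bxor] at hi
        cases hai : a i with
        | true => exact (mem_filter.1 ha).2 i hai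
        | false => rw [hai] at hi; exact (mem_filter.1 ha').2 i (by simpa using hi)
      have hRC := fo_card_mul_le_inter R C haddR haddC
      have hCcard : #C = 16 := by rw [hCdef, bb_card_cube, h4]; norm_num
      rw [hCcard] at hRC
      norm_num at hRC
      have h2 : 1 < #(R ∩ C) := by omega
      obtain ⟨a, ha, ha0⟩ := exists_mem_ne h2 zeroVec
      have haR : a ∈ R := (mem_inter.1 ha).1
      have haC : ∀ i, a i = true → i ∈ I := (mem_filter.1 (mem_inter.1 ha).2).2
      exact fo_quad_cube4 (fun x => decide (Odd (u x / 2))) hP1 I h4 a haC ha0 (mem_filter.1 haR).2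
    · obtain ⟨z'', hz''⟩ := td_count_cube (by norm_num : 1 ≤ 2) (fun x => decide (Odd (u x / 2))) hP1 I
      obtain ⟨e, he⟩ : ∃ e, #I = e + 5 := ⟨#I - 5, by omega⟩
      obtain ⟨e', he'⟩ : ∃ e', (#I + 2 - 1) / 2 = e' + 3 := ⟨(#I + 2 - 1) / 2 - 3, by omega⟩
      rw [he', he, show (2 : ℤ) ^ (e + 5) = 2 ^ e * 32 by rw [pow_add]; norm_num,
        show (2 : ℤ) ^ (e' + 3) = 2 ^ e' * 8 by rw [pow_add]; norm_num] at hz''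
      exact ⟨2 ^ e * 4 - 2 ^ e' * z'', by linarith⟩
  have hsplit : ∑ x ∈ {x : Fin (7 + 7) → Bool | ∀ i, x i = true → i ∈ I}, u x =
      2 * (2 * ∑ x ∈ {x : Fin (7 + 7) → Bool | ∀ i, x i = true → i ∈ I}, u x / 2 / 2 +
        #{x : Fin (7 + 7) → Bool | (∀ i, x i = true → i ∈ I) ∧ decide (Odd (u x / 2)) = true}) +
        #{x : Fin (7 + 7) → Bool | (∀ i, x i = true → i ∈ I) ∧ decide (Odd (u x)) = true} := by
    rw [sum_congr rfl fun x _ => td_two_mul_div_add (u x), sum_add_distrib, ← mul_sum, td_sum_ite_odd, filter_filter,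
      sum_congr rfl fun x _ => td_two_mul_div_add (u x / 2), sum_add_distrib, ← mul_sum, td_sum_ite_odd, filter_filter]
    simp only [decide_eq_true_eq]
  have hE : Even (∑ x ∈ {x : Fin (7 + 7) → Bool | ∀ i, x i = true → i ∈ I}, u x / 2 / 2) := by
    obtain ⟨q, hq⟩ := h8
    obtain ⟨a, ha⟩ := hA
    obtain ⟨b, hb⟩ := hB
    refine ⟨q - a - b, ?_⟩
    have := hsplit
    rw [hq, ha, hb] at this
    linarith
  have hE' := (tw_even_sum_iff _ (fun x => u x / 2 / 2)).1 hE
  rw [filter_filter] at hE'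
  simpa only [decide_eq_true_eq] using hE'

end Summit.QuantumAdvantage.QuantumAdvantage.Theorems.CubicForrelation.NearExactIsExact

end
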